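import Summits.CriticalPhenomena.SAWScalingLimit.Theorems.SAWDevelopingMapObservableToSLERestrictionIdentifies
import Literature.Probability.RandomPlanarGeometry.HullDecomposition
import Literature.Probability.RandomPlanarGeometry.HullApproximation
import HarnessLib

/-!
# Crux `SAWDefectDecoherence.ObservableToSLER` (stmt-CriticalPhenomena-14005), line
`bridge-gate-renewal` (r7), stub 5a3 `stub_twoPieceAdmIdentification`: the EXCLUSION SET of a
hull subdomain (pulled-back hull with two real whiskers, imaged by the boundary extension)

Landing target:
`Summits/CriticalPhenomena/SAWScalingLimit/Theorems/SAWDefectDecoherenceObservableToSLERTwoPieceAdmIdentificationExclusion.lean`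
(`--supports stmt-CriticalPhenomena-14005`).

For a two-piece flat Dobrushin domain `(M; a, b)`, a hull subdomain `M'` and a chordal
uniformizing map `φ : (ℍ; 0, ∞) → (M; a, b)` with pulled-back `*`-hull `A` of `M'`, the
admissible sub-families of stub 5a3 are carved out of the given admissible family by excluding
the vertices near `T = φ̂(A ∪ W)`, `W = [-X, -x₀] ∪ [x₀, X] ⊆ ℝ` two real whiskers with
`A ∩ ℝ ⊆ W ∌ 0` whose far ends `±X` are mapped into the flat ball at `b` within `ρ/4`.
`exists_exclusionSet` records what the lattice construction needs of `T`: compact, off `a, b`,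
`M ∖ M' ⊆ T`, `T ∩ M' = ∅`, `φ̂(A) ⊆ T ⊆ φ̂(A) ∪ (∂M ∖ {a, b})`, and ESCAPABILITY: every point of
`T` lies in a preconnected subset of `T` containing a floor point `q` of the flat ball at `b`
(`Im q = Im b`, `|q - b| < ρ/4`) — for `φ̂(α)`, `α ∈ A`, the image of the connected component of
`α` in `A`, which reaches a nonzero real point (`IsStarHull.exists_real_mem_connectedComponentIn`),
together with the whisker through that point.
-/

noncomputable section

open scoped Topology
open Filter Set Metric Complex
open UpperHalfPlane (upperHalfPlaneSet)
open Literature.Probability.RandomPlanarGeometry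

namespace Summit.CriticalPhenomena.SAWScalingLimit.Theorems.ObservableToSLER.TwoPiece

open Summit.CriticalPhenomena.SAWScalingLimit.Theorems.ObservableToSLE.FloorRatio

/-- **The frontier of a flat domain inside the flat ball is the floor line.** [folklore] -/
theorem im_eq_of_mem_frontier_of_flat {Ω : Set ℂ} (hΩ : IsOpen Ω) {p : ℂ} {ρ : ℝ}
    (hflat : Ω ∩ ball p ρ = {z : ℂ | p.im < z.im} ∩ ball p ρ) {q : ℂ} (hq : q ∈ frontier Ω)
    (hqp : dist q p < ρ) : q.im = p.im := by
  have hqΩ : q ∉ Ω := fun h => by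
    have : q ∈ Ω ∩ frontier Ω := ⟨h, hq⟩
    rw [hΩ.inter_frontier_eq] at this
    exact this
  rcases lt_trichotomy q.im p.im with hlt | heq | hgt
  · -- below the floor: a neighbourhood misses `Ω`
    exfalso
    have hU : IsOpen (ball p ρ ∩ {z : ℂ | z.im < p.im}) :=
      isOpen_ball.inter (isOpen_lt Complex.continuous_im continuous_const)
    have hqU : q ∈ ball p ρ ∩ {z : ℂ | z.im < p.im} := ⟨mem_ball.2 hqp, hlt⟩
    have hcl : q ∈ closure Ω := frontier_subset_closure hq
    rw [mem_closure_iff_nhds] at hcl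
    obtain ⟨z, hzU, hzΩ⟩ := hcl _ (hU.mem_nhds hqU)
    have : z ∈ Ω ∩ ball p ρ := ⟨hzΩ, hzU.1⟩
    rw [hflat] at this
    have h1 : p.im < z.im := this.1
    have h2 : z.im < p.im := hzU.2
    exact lt_asymm h1 h2
  · exact heq
  · exfalso
    have : q ∈ {z : ℂ | p.im < z.im} ∩ ball p ρ := ⟨hgt, mem_ball.2 hqp⟩
    rw [← hflat] at this
    exact hqΩ this.1

/-- Along `n ↦ σ n` (`σ = ±1`) the boundary extension of a chordal uniformizing map tends to the
second marked point (Carathéodory's disc extension is continuous at `1 = C(∞)`). [cite: PommerenkeBBCM1992, Thm. 2.6] -/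
theorem tendsto_boundaryExtension_natCast {M : DobrushinDomain}
    {φ : ConformalEquiv upperHalfPlaneSet M.carrier} {Ψ : ℂ → ℂ}
    (hΨ : JordanDomain.IsDiscExtension M.toJordanDomain φ Ψ) (hφ : M.IsChordalUniformizing φ)
    {σ : ℝ} (hσ : σ = 1 ∨ σ = -1) :
    Tendsto (fun n : ℕ => φ.boundaryExtension ((σ * n : ℝ) : ℂ)) atTop (𝓝 (M.pt 1)) := by
  have h1 : ∀ n : ℕ, φ.boundaryExtension ((σ * n : ℝ) : ℂ) = Ψ (cayleyFun ((σ * n : ℝ) : ℂ)) :=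
    fun n => hΨ.boundaryExtension_eq (by simp)
  simp_rw [h1]
  rw [← hΨ.apply_one_eq hφ.2]
  have hf : Tendsto (fun n : ℕ => ((σ * n : ℝ) : ℂ)) atTop (cocompact ℂ) := by
    refine tendsto_cocompact_of_tendsto_dist_comp_atTop (0 : ℂ) ?_
    have : (fun n : ℕ => dist ((σ * n : ℝ) : ℂ) 0) = fun n : ℕ => (n : ℝ) := by
      funext n
      rw [dist_zero_right, Complex.norm_real, Real.norm_eq_abs, abs_mul]
      rcases hσ with rfl | rfl <;> simp
    rw [this]
    exact tendsto_natCast_atTop_atTop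
  have hC : Tendsto (fun n : ℕ => cayleyFun ((σ * n : ℝ) : ℂ)) atTop (𝓝[closedBall 0 1] 1) := by
    refine tendsto_nhdsWithin_iff.2 ⟨tendsto_cayleyFun_cocompact.comp hf, Eventually.of_forall
      fun n => mem_closedBall_zero_iff.2 (norm_cayleyFun_le_one (by simp))⟩
  exact ((hΨ.continuousOn 1 (mem_closedBall_zero_iff.2 (by simp))).tendsto).comp hC

/-- **THE EXCLUSION SET OF A HULL SUBDOMAIN** (see the module docstring).
[cite: LawlerSchrammWerner2003Restriction, §2 pp. 7–8 (hulls), transposed; PommerenkeBBCM1992, Thm. 2.6] -/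
theorem exists_exclusionSet {M M' : DobrushinDomain} {ρ : ℝ}
    (hflat : 0 < ρ ∧ ∀ i : Fin 2, M.carrier ∩ ball (M.pt i) ρ =
      {z : ℂ | (M.pt i).im < z.im} ∩ ball (M.pt i) ρ)
    (hM' : M.IsHullSubdomain M') {φ : ConformalEquiv upperHalfPlaneSet M.carrier}
    (hφ : M.IsChordalUniformizing φ) :
    ∃ T : Set ℂ, IsCompact T ∧ M.pt 0 ∉ T ∧ M.pt 1 ∉ T ∧ M.carrier \ M'.carrier ⊆ T ∧
      Disjoint T M'.carrier ∧
      (∀ y ∈ T, ∃ Ty ⊆ T, IsPreconnected Ty ∧ y ∈ Ty ∧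
        ∃ q ∈ Ty, q.im = (M.pt 1).im ∧ dist q (M.pt 1) < ρ / 4) ∧
      φ.boundaryExtension '' φ.pullbackHull M' ⊆ T ∧
      T ⊆ φ.boundaryExtension '' φ.pullbackHull M' ∪ (frontier M.carrier \ {M.pt 0, M.pt 1}) := by
  classical
  obtain ⟨hρ, hflat'⟩ := hflat
  have hsc : ∀ D : JordanDomain, D.isSimplyConnected := JordanDomain.isSimplyConnected_holds
  have hC : JordanDomain.exists_continuousOn_extension := JordanDomain.exists_continuousOn_extension_holds
  obtain ⟨Ψ, hΨ⟩ := JordanDomain.exists_isDiscExtension hC φ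
  set A : Set ℂ := φ.pullbackHull M' with hAdef
  have hA : IsStarHull A := IsStarHull.pullbackHull hsc hφ hM'
  set ψ : ℂ → ℂ := φ.boundaryExtension with hψ
  have hcont : ContinuousOn ψ (closure upperHalfPlaneSet) :=
    JordanDomain.continuousOn_boundaryExtension_of_disc hC M.toJordanDomain φ
  -- basic values and injectivity
  have hψ0 : ψ 0 = M.pt 0 :=
    JordanDomain.boundaryExtension_eq_of_hasBoundaryValue' φ (by simp) hφ.1
  have hΨ1 : Ψ 1 = M.pt 1 := hΨ.apply_one_eq hφ.2
  have hψeq : ∀ {z : ℂ}, 0 ≤ z.im → ψ z = Ψ (cayleyFun z) := fun hz => hΨ.boundaryExtension_eq hz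
  have hinj0 : ∀ {z : ℂ}, 0 ≤ z.im → ψ z = M.pt 0 → z = 0 := by
    intro z hz h
    rw [← hψ0, hψeq hz, hψeq (le_refl (0 : ℂ).im)] at h
    have h' := hΨ.bijOn.injOn (mem_closedBall_zero_iff.2 (norm_cayleyFun_le_one hz))
      (mem_closedBall_zero_iff.2 (norm_cayleyFun_le_one (by simp))) h
    have := congrArg cayleyInvFun h'
    rwa [cayleyInvFun_cayleyFun (add_I_ne_zero hz), cayleyInvFun_cayleyFun (add_I_ne_zero (by simp))]
      at this
  have hne1 : ∀ {z : ℂ}, 0 ≤ z.im → ψ z ≠ M.pt 1 := by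
    intro z hz h
    rw [← hΨ1, hψeq hz] at h
    exact cayleyFun_ne_one z (hΨ.bijOn.injOn (mem_closedBall_zero_iff.2 (norm_cayleyFun_le_one hz))
      (mem_closedBall_zero_iff.2 (by simp)) h)
  -- `x₀`: real points of `A` are `≥ x₀ > 0` in absolute value
  obtain ⟨ε, hε, hεA⟩ := Metric.isOpen_iff.1 hA.1.isClosed.isOpen_compl 0 hA.2
  set x₀ : ℝ := ε / 2 with hx₀
  have hx₀pos : 0 < x₀ := by positivity
  have hAx₀ : ∀ x : ℝ, (x : ℂ) ∈ A → x₀ ≤ |x| := by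
    intro x hx
    by_contra hlt
    push Not at hlt
    refine hεA (mem_ball_zero_iff.2 ?_) hx
    rw [Complex.norm_real, Real.norm_eq_abs]
    linarith
  -- `X`: beyond the hull, and `ψ(±X)` within `ρ/4` of `b`
  obtain ⟨R, hR⟩ := hA.1.1.subset_closedBall 0
  have htail : ∀ σ : ℝ, (σ = 1 ∨ σ = -1) → ∃ N : ℕ, ∀ n : ℕ, N ≤ n →
      dist (ψ ((σ * n : ℝ) : ℂ)) (M.pt 1) < ρ / 4 := fun σ hσ =>
    eventually_atTop.1 ((tendsto_boundaryExtension_natCast hΨ hφ hσ).eventually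
      (ball_mem_nhds _ (by positivity)))
  obtain ⟨N₁, hN₁⟩ := htail 1 (Or.inl rfl)
  obtain ⟨N₂, hN₂⟩ := htail (-1) (Or.inr rfl)
  set n : ℕ := max (max N₁ N₂) (max ⌈R⌉₊ ⌈x₀⌉₊) with hn
  set X : ℝ := (n : ℝ) with hXdef
  have hx₀X : x₀ ≤ X := (Nat.le_ceil x₀).trans (by
    rw [hXdef]; exact_mod_cast (le_max_right _ _).trans (le_max_right _ _))
  have hRX : R ≤ X := (Nat.le_ceil R).trans (by
    rw [hXdef]; exact_mod_cast (le_max_left _ _).trans (le_max_right _ _))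
  have hXpos : dist (ψ (X : ℂ)) (M.pt 1) < ρ / 4 := by
    have := hN₁ n ((le_max_left _ _).trans (le_max_left _ _))
    rwa [one_mul] at this
  have hXneg : dist (ψ ((-X : ℝ) : ℂ)) (M.pt 1) < ρ / 4 := by
    have := hN₂ n ((le_max_right _ _).trans (le_max_left _ _))
    rwa [neg_one_mul] at this
  -- the whiskers
  set W₁ : Set ℂ := (fun x : ℝ => (x : ℂ)) '' Icc x₀ X with hW₁
  set W₂ : Set ℂ := (fun x : ℝ => (x : ℂ)) '' Icc (-X) (-x₀) with hW₂
  set W : Set ℂ := W₂ ∪ W₁ with hWdef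
  have hWreal : ∀ z ∈ W, ∃ x : ℝ, z = x ∧ x₀ ≤ |x| := by
    rintro z (⟨x, hx, rfl⟩ | ⟨x, hx, rfl⟩)
    · exact ⟨x, rfl, by rw [abs_of_neg (by linarith [hx.2])]; linarith [hx.2]⟩
    · exact ⟨x, rfl, by rw [abs_of_pos (by linarith [hx.1])]; exact hx.1⟩
  have h0W : (0 : ℂ) ∉ W := fun h => by
    obtain ⟨x, hx, hx₀⟩ := hWreal 0 h
    have : x = 0 := by exact_mod_cast hx.symm
    rw [this, abs_zero] at hx₀
    linarith
  have hAcl : A ⊆ closure upperHalfPlaneSet := hA.1.subset_closure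
  have hWcl : W ⊆ closure upperHalfPlaneSet := fun z hz => by
    obtain ⟨x, rfl, -⟩ := hWreal z hz
    exact mem_closure_upperHalfPlaneSet_iff.2 (by simp)
  have hAWcl : A ∪ W ⊆ closure upperHalfPlaneSet := union_subset hAcl hWcl
  have him : ∀ z ∈ A ∪ W, 0 ≤ z.im := fun z hz => mem_closure_upperHalfPlaneSet_iff.1 (hAWcl hz)
  -- frontier points and the floor at `b`
  have hfrW : ∀ x : ℝ, ψ (x : ℂ) ∈ frontier M.carrier := fun x =>
    hΨ.boundaryExtension_ofReal_mem_frontier x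
  have hfloor : ∀ x : ℝ, dist (ψ (x : ℂ)) (M.pt 1) < ρ / 4 → (ψ (x : ℂ)).im = (M.pt 1).im :=
    fun x hx => im_eq_of_mem_frontier_of_flat M.isOpen (hflat' 1) (hfrW x) (by linarith)
  -- the whisker through a real point `x` with `x₀ ≤ |x| ≤ X`
  have whisker : ∀ x : ℝ, x₀ ≤ |x| → |x| ≤ X → ∃ V ⊆ W, IsPreconnected V ∧ (x : ℂ) ∈ V ∧
      ∃ e ∈ V, (ψ e).im = (M.pt 1).im ∧ dist (ψ e) (M.pt 1) < ρ / 4 := by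
    intro x hx₀x hxX
    rcases lt_or_ge 0 x with hpos | hnp
    · rw [abs_of_pos hpos] at hx₀x hxX
      refine ⟨W₁, subset_union_right, (isPreconnected_Icc.image _ continuous_ofReal.continuousOn),
        ⟨x, ⟨hx₀x, hxX⟩, rfl⟩, (X : ℂ), ⟨X, ⟨hx₀X, le_rfl⟩, rfl⟩, hfloor X hXpos, hXpos⟩
    · have hneg : x < 0 := lt_of_le_of_ne hnp fun h => by rw [h, abs_zero] at hx₀x; linarith
      rw [abs_of_neg hneg] at hx₀x hxX
      refine ⟨W₂, subset_union_left, (isPreconnected_Icc.image _ continuous_ofReal.continuousOn),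
        ⟨x, ⟨by linarith, by linarith⟩, rfl⟩, ((-X : ℝ) : ℂ), ⟨-X, ⟨le_rfl, by linarith⟩, rfl⟩,
        hfloor (-X) hXneg, hXneg⟩
  -- THE SET
  refine ⟨ψ '' (A ∪ W), ?_, ?_, ?_, ?_, ?_, ?_, image_mono subset_union_left, ?_⟩
  · exact (hA.1.isCompact.union ((isCompact_Icc.image continuous_ofReal).union
      (isCompact_Icc.image continuous_ofReal))).image_of_continuousOn (hcont.mono hAWcl)
  · rintro ⟨z, hz, h⟩
    have := hinj0 (him z hz) h
    subst this
    rcases hz with hz | hz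
    · exact hA.2 hz
    · exact h0W hz
  · rintro ⟨z, hz, h⟩
    exact hne1 (him z hz) h
  · exact diff_subset_image_pullbackHull.trans (image_mono subset_union_left)
  · refine Set.disjoint_left.2 ?_
    rintro _ ⟨z, hz, rfl⟩ hM'mem
    rcases (him z hz).lt_or_eq with hpos | h0
    · -- `z ∈ A ∩ ℍ`, so `φ z ∉ M'`
      have hzA : z ∈ A := by
        rcases hz with hz | hz
        · exact hz
        · obtain ⟨x, rfl, -⟩ := hWreal z hz
          simp at hpos
      have hzH : z ∈ upperHalfPlaneSet := hpos
      have hmem : z ∈ A ∩ upperHalfPlaneSet := ⟨hzA, hzH⟩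
      rw [hAdef, ConformalEquiv.pullbackHull_inter] at hmem
      rw [hψ, φ.boundaryExtension_eq hzH] at hM'mem
      exact hmem.2 ⟨hzH, hM'mem⟩
    · have hzre : z = (z.re : ℂ) := Complex.ext (by simp) (by simp [← h0])
      rw [hzre] at hM'mem
      exact M.toJordanDomain.notMem_frontier_of_mem (hM'.carrier_subset hM'mem) (hfrW z.re)
  · rintro _ ⟨z, hz, rfl⟩
    rcases hz with hzA | hzW
    · -- through the connected component of `z` in `A` and a whisker
      obtain ⟨x, hx0, hxC⟩ := hA.exists_real_mem_connectedComponentIn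
        hA.1.isConnected_union_im_nonpos hzA
      have hxA : (x : ℂ) ∈ A := connectedComponentIn_subset _ _ hxC
      have hxX : |x| ≤ X := by
        have := hR hxA
        rw [mem_closedBall_zero_iff, Complex.norm_real, Real.norm_eq_abs] at this
        exact this.trans hRX
      obtain ⟨V, hVW, hV, hxV, e, heV, heim, hedist⟩ := whisker x (hAx₀ x hxA) hxX
      have hsub : connectedComponentIn A z ∪ V ⊆ A ∪ W :=
        union_subset_union (connectedComponentIn_subset _ _) hVW
      refine ⟨ψ '' (connectedComponentIn A z ∪ V), image_mono hsub,
        (IsPreconnected.union (x : ℂ) hxC hxV isPreconnected_connectedComponentIn hV).image _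
          (hcont.mono (hsub.trans hAWcl)),
        ⟨z, Or.inl (mem_connectedComponentIn hzA), rfl⟩, ψ e, ⟨e, Or.inr heV, rfl⟩, heim, hedist⟩
    · obtain ⟨x, rfl, hx₀x⟩ := hWreal _ hzW
      have hxX : |x| ≤ X := by
        rcases hzW with ⟨x', hx', hxx'⟩ | ⟨x', hx', hxx'⟩
        · have : x' = x := by exact_mod_cast (show ((x' : ℝ) : ℂ) = x from hxx')
          subst this; rw [abs_of_neg (by linarith [hx'.2])]; linarith [hx'.1]
        · have : x' = x := by exact_mod_cast (show ((x' : ℝ) : ℂ) = x from hxx')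
          subst this; rw [abs_of_pos (by linarith [hx'.1])]; exact hx'.2
      obtain ⟨V, hVW, hV, hxV, e, heV, heim, hedist⟩ := whisker x hx₀x hxX
      exact ⟨ψ '' V, image_mono (hVW.trans subset_union_right),
        hV.image _ (hcont.mono (hVW.trans hWcl)), ⟨x, hxV, rfl⟩, ψ e, ⟨e, heV, rfl⟩, heim, hedist⟩
  · rintro _ ⟨z, hz, rfl⟩
    rcases hz with hzA | hzW
    · exact Or.inl ⟨z, hzA, rfl⟩
    · obtain ⟨x, rfl, -⟩ := hWreal _ hzW
      refine Or.inr ⟨hfrW x, ?_⟩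
      rintro (h | h)
      · have := hinj0 (by simp) h
        exact h0W (by rw [← this]; exact hzW)
      · exact hne1 (by simp) h

/-! ### Registry form -/

/-- **Registered sub-goal `stub_twoPieceAdmIdentification_exclusion`** (crux item stmt-CriticalPhenomena-14005, line
`bridge-gate-renewal`, stub `stub_twoPieceAdmIdentification`): registry form of `exists_exclusionSet` — the exclusion set of a hull subdomain. [cite: LawlerSchrammWerner2003Restriction, §2 pp. 7–8 (hulls), transposed; PommerenkeBBCM1992, Thm. 2.6] -/
theorem stub_twoPieceAdmIdentification_exclusion :
    ∀ (M M' : DobrushinDomain) (ρ : ℝ) (φ : ConformalEquiv upperHalfPlaneSet M.carrier),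
      (0 < ρ ∧ ∀ i : Fin 2, M.carrier ∩ ball (M.pt i) ρ =
        {z : ℂ | (M.pt i).im < z.im} ∩ ball (M.pt i) ρ) →
      M.IsHullSubdomain M' → M.IsChordalUniformizing φ →
      ∃ T : Set ℂ, IsCompact T ∧ M.pt 0 ∉ T ∧ M.pt 1 ∉ T ∧ M.carrier \ M'.carrier ⊆ T ∧
        Disjoint T M'.carrier ∧
        (∀ y ∈ T, ∃ Ty ⊆ T, IsPreconnected Ty ∧ y ∈ Ty ∧
        ∃ q ∈ Ty, q.im = (M.pt 1).im ∧ dist q (M.pt 1) < ρ / 4) ∧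
        φ.boundaryExtension '' φ.pullbackHull M' ⊆ T ∧
        T ⊆ φ.boundaryExtension '' φ.pullbackHull M' ∪ (frontier M.carrier \ {M.pt 0, M.pt 1}) :=
  fun _ _ _ _ hflat hM' hφ => exists_exclusionSet hflat hM' hφ

end Summit.CriticalPhenomena.SAWScalingLimit.Theorems.ObservableToSLER.TwoPiece

end
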